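/- Fleet lead `ym-wcr-19456-p1`, route `WeakCouplingRates`, crux `ColdBoxTwoPointFloorW` (stmt-QuantumFields-19608). -/
import Summits.QuantumFields.YangMills.Theorems.WeakCouplingRatesColdBoxForestGauge
import Summits.QuantumFields.YangMills.Theorems.WeakCouplingRatesColdBoxDirichletPosDef

/-!
# Crux `ColdBoxTwoPointFloor(W)`, piece S3c-ii step 3: the quantitative NONLINEAR POINCARÉ bounds in the temporal-forest
# gauge of the cold-wall box — every gauge-fixed link is within `(12H²+2H+1)·M` of `1`, `M` = the largest plaquette deviation

Abstract setting: a group `G`, a length function `ℓ : G → ℝ` with `ℓ 1 = 0`, `ℓ(xy) ≤ ℓx + ℓy`, `ℓ(x⁻¹) = ℓx` (e.g. `‖ρ(·) − 1‖` for a unitary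
representation: `opDist1`), and a configuration `V` on `ℤ⁴` which is `1` off the cold box `Λ = boxEdges 4 (2H+1)` (cold wall) and on the
temporal forest (the gauge-fixed configuration `forestFix H (coldExt u)` of the sibling files `…ColdBoxForestGauge*`), with all
plaquette deviations `ℓ(V_p) ≤ M`.  Then (Chatterjee's Lemma 10.2 / 13.1 for the comb, here for the cold-wall forest):
* `ell_temporal_face` — a temporal link whose base point has a transverse coordinate on a face is a single boundary plaquette: `≤ M`;
* `ell_temporal_of_pos` — every temporal link at height `≥ 1` is `≤ M` (forest, face, or outside);
* `ell_spatial` — spatial links at height `2H − k` (`k ≤ 2H−1`): `≤ (3k+1)·M` (downward induction from the top face: thin loops);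
* `ell_spatial_bottom` — bottom-face spatial links: `≤ M`;
* `ell_temporal_bottom` — the bottom temporal links `V((0,x'), e₀)` (full temporal-line holonomies closed through the cold wall —
  the only links whose loop has area `∼ H·dist`): `≤ ((2H − x₁)(6H+1) + 1)·M` by induction towards the face `x₁ = 2H`;
* `ell_le_uniform` — **every link: `ℓ(V_e) ≤ (12H² + 2H + 1)·M`** (`H ≥ 1`).
On the small-field event (`M = O(β^{ε−1/2})`) this is the sup-norm link bound `η = O(H²·β^{ε−1/2})` of the one-scale expansion
(`H = ⌈β^θ⌉`: `η → 0` iff `2θ + ε < 1/2`) feeding the cubic remainder `abs_plaquetteCost_sub_sq_norm_le` (`…ColdBoxCubic`).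
Everything proved; no definition; standard axioms.
-/

set_option autoImplicit false

noncomputable section

open Literature.Probability.LatticeModels (Site)
open Literature.MathematicalPhysics.QuantumLattice
open Literature.MathematicalPhysics.QuantumFieldTheory
open Literature.MathematicalPhysics.QuantumFieldTheory.AxialGauge

namespace Summit.QuantumFields.YangMills.Theorems.WeakCouplingRates

section Poincare

variable {G : Type*} [Group G] {H : ℕ}
variable (ℓ : G → ℝ) (hℓ1 : ℓ 1 = 0) (hℓmul : ∀ x y, ℓ (x * y) ≤ ℓ x + ℓ y) (hℓinv : ∀ x, ℓ x⁻¹ = ℓ x)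
variable (V : LGConfig 4 G)
  (hout : ∀ e, e ∉ boxEdges 4 (2 * H + 1) → V e = 1)
  (hforest : ∀ x : Site 4, (∀ k : Fin 4, 1 ≤ x k ∧ x k + 1 ≤ 2 * (H : ℤ)) → V (x, 0) = 1)
  {M : ℝ} (hM : ∀ (x : Site 4) (i j : Fin 4), ℓ (plaquetteHolonomyZd V x i j) ≤ M)

include hℓ1 hM in
/-- `0 ≤ M` (the holonomy of a degenerate plaquette is `1`). -/
theorem poincare_M_nonneg : 0 ≤ M := by
  have h := hM 0 0 0
  have : plaquetteHolonomyZd V 0 0 0 = 1 := by simp [plaquetteHolonomyZd]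
  rw [this, hℓ1] at h; exact h

/-- The plaquette holonomy in the `(0, i)` plane, spelled out. -/
theorem hol_eq (x : Site 4) (i : Fin 4) :
    plaquetteHolonomyZd V x 0 i = V (x, 0) * V (x + Pi.single 0 1, i) * (V (x + Pi.single i 1, 0))⁻¹ * (V (x, i))⁻¹ := rfl

include hout in
/-- An edge whose base point has a coordinate above `2H` or below `0` carries `1`. -/
theorem V_eq_one_of_fst {x : Site 4} {i : Fin 4} (hx : ∃ k, x k < 0 ∨ 2 * (H : ℤ) < x k) : V (x, i) = 1 :=
  hout _ (not_mem_boxEdges_of_fst hx)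

include hout in
/-- An edge whose far endpoint leaves the box carries `1`. -/
theorem V_eq_one_of_snd {x : Site 4} {i : Fin 4}
    (hx : ∃ k : Fin 4, (x + Pi.single i (1 : ℤ) : Site 4) k < 0 ∨ 2 * (H : ℤ) < (x + Pi.single i (1 : ℤ) : Site 4) k) :
    V (x, i) = 1 :=
  hout _ (not_mem_boxEdges_of_snd hx)

include hℓinv hout hM in
/-- **(A) Boundary temporal links are single boundary plaquettes**: if `y` has a transverse coordinate on a face
(`y_j ∈ {0, 2H}`, `j ≠ 0`), then `ℓ(V(y, e₀)) ≤ M`. -/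
theorem ell_temporal_face {y : Site 4} {j : Fin 4} (hj : j ≠ 0) (hy : y j = 0 ∨ y j = 2 * (H : ℤ)) :
    ℓ (V (y, 0)) ≤ M := by
  rcases hy with hy | hy
  · -- plaquette (y - e_j; 0, j): holonomy = V(y,0)⁻¹
    have h := hM (y - Pi.single j 1) 0 j
    rw [hol_eq] at h
    have e1 : V (y - Pi.single j 1, 0) = 1 :=
      V_eq_one_of_fst V hout ⟨j, Or.inl (by simp [hy])⟩
    have e2 : V (y - Pi.single j 1 + Pi.single 0 1, j) = 1 :=
      V_eq_one_of_fst V hout ⟨j, Or.inl (by simp [Pi.single_eq_of_ne hj, hy])⟩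
    have e3 : y - Pi.single j 1 + Pi.single j 1 = y := by simp
    have e4 : V (y - Pi.single j 1, j) = 1 :=
      V_eq_one_of_fst V hout ⟨j, Or.inl (by simp [hy])⟩
    rw [e1, e2, e3, e4, one_mul, one_mul, inv_one, mul_one, hℓinv] at h
    exact h
  · -- plaquette (y; 0, j): holonomy = V(y,0)
    have h := hM y 0 j
    rw [hol_eq] at h
    have e2 : V (y + Pi.single 0 1, j) = 1 :=
      V_eq_one_of_snd V hout ⟨j, Or.inr (by simp [Pi.single_eq_of_ne hj, Pi.single_eq_same, hy])⟩
    have e3 : V (y + Pi.single j 1, 0) = 1 :=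
      V_eq_one_of_fst V hout ⟨j, Or.inr (by simp [hy])⟩
    have e4 : V (y, j) = 1 :=
      V_eq_one_of_snd V hout ⟨j, Or.inr (by simp [hy])⟩
    rw [e2, e3, e4, mul_one, inv_one, mul_one, mul_one] at h
    exact h

include hℓ1 hℓinv hout hforest hM in
/-- Temporal links at height `≥ 1` inside the box are `1` (forest) or single boundary plaquettes: `ℓ ≤ M`. -/
theorem ell_temporal_of_pos {z : Site 4} (hz0 : 1 ≤ z 0) : ℓ (V (z, 0)) ≤ M := by
  have hM0 := poincare_M_nonneg ℓ hℓ1 V hM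
  by_cases hin : ∀ k : Fin 4, 1 ≤ z k ∧ z k + 1 ≤ 2 * (H : ℤ)
  · rw [hforest z hin, hℓ1]; exact hM0
  · by_cases hmem : (z, (0 : Fin 4)) ∈ boxEdges 4 (2 * H + 1)
    · -- in the box, not interior, height ≥ 1: some transverse coordinate is on a face
      rw [mem_boxEdges_iff] at hmem
      push Not at hin
      obtain ⟨k, hk⟩ := hin
      have hk0 : k ≠ 0 := by
        rintro rfl; have := hmem.2; push_cast at this; omega
      have hzk := hmem.1 k
      push_cast at hzk
      have hface : z k = 0 ∨ z k = 2 * (H : ℤ) := by omega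
      exact ell_temporal_face ℓ hℓinv V hout hM hk0 hface
    · rw [hout _ hmem, hℓ1]; exact hM0

include hℓ1 hℓmul hℓinv hout hforest hM in
/-- **(S) Spatial links by downward induction from the top face**: a spatial link `(x, i)` (`i ≠ 0`) at height
`x₀ = 2H − k` with `k ≤ 2H − 1` has `ℓ(V(x,i)) ≤ (3k + 1)·M` (each step down costs the plaquette below the previous link and the
two temporal links, each `≤ M`). -/
theorem ell_spatial : ∀ (k : ℕ) (x : Site 4) (i : Fin 4), i ≠ 0 → x 0 = 2 * (H : ℤ) - k → (k : ℤ) ≤ 2 * H - 1 →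
    ℓ (V (x, i)) ≤ (3 * k + 1) * M := by
  have hM0 := poincare_M_nonneg ℓ hℓ1 V hM
  intro k
  induction k with
  | zero =>
    intro x i hi hx _
    -- top face: the plaquette (x; 0, i) has three outside links
    have h := hM x 0 i
    rw [hol_eq] at h
    have e1 : V (x, 0) = 1 := V_eq_one_of_snd V hout ⟨0, Or.inr (by simp; omega)⟩
    have e2 : V (x + Pi.single 0 1, i) = 1 := V_eq_one_of_fst V hout ⟨0, Or.inr (by simp; omega)⟩
    have e3 : V (x + Pi.single i 1, 0) = 1 :=
      V_eq_one_of_snd V hout ⟨0, Or.inr (by simp [Pi.single_eq_of_ne hi.symm]; omega)⟩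
    rw [e1, e2, e3, one_mul, one_mul, inv_one, one_mul, hℓinv] at h
    simpa using h
  | succ k ih =>
    intro x i hi hx hk
    have h := hM x 0 i
    rw [hol_eq] at h
    -- V(x,i) = hol⁻¹ · V(x,0) · V(x+e₀,i) · V(x+eᵢ,0)⁻¹
    have hsolve : V (x, i) = (plaquetteHolonomyZd V x 0 i)⁻¹ * (V (x, 0) * V (x + Pi.single 0 1, i) *
        (V (x + Pi.single i 1, 0))⁻¹) := by
      rw [hol_eq]; group
    have hup : ℓ (V (x + Pi.single 0 1, i)) ≤ (3 * k + 1) * M :=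
      ih (x + Pi.single 0 1) i hi (by simp; omega) (by push_cast at hk ⊢; omega)
    have ht1 : ℓ (V (x, 0)) ≤ M := ell_temporal_of_pos ℓ hℓ1 hℓinv V hout hforest hM (by push_cast at hk; omega)
    have ht2 : ℓ (V (x + Pi.single i 1, 0)) ≤ M :=
      ell_temporal_of_pos ℓ hℓ1 hℓinv V hout hforest hM (by simp [Pi.single_eq_of_ne hi.symm]; push_cast at hk; omega)
    rw [hsolve]
    calc ℓ ((plaquetteHolonomyZd V x 0 i)⁻¹ * (V (x, 0) * V (x + Pi.single 0 1, i) * (V (x + Pi.single i 1, 0))⁻¹))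
        ≤ ℓ (plaquetteHolonomyZd V x 0 i)⁻¹ + ℓ (V (x, 0) * V (x + Pi.single 0 1, i) * (V (x + Pi.single i 1, 0))⁻¹) :=
          hℓmul _ _
      _ ≤ M + (M + (3 * k + 1) * M + M) := by
          refine add_le_add (by rw [hℓinv]; exact hM x 0 i) ?_
          calc ℓ (V (x, 0) * V (x + Pi.single 0 1, i) * (V (x + Pi.single i 1, 0))⁻¹)
              ≤ ℓ (V (x, 0) * V (x + Pi.single 0 1, i)) + ℓ (V (x + Pi.single i 1, 0))⁻¹ := hℓmul _ _
            _ ≤ (ℓ (V (x, 0)) + ℓ (V (x + Pi.single 0 1, i))) + ℓ (V (x + Pi.single i 1, 0)) := by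
                rw [hℓinv]; exact add_le_add (hℓmul _ _) le_rfl
            _ ≤ M + (3 * k + 1) * M + M := by linarith
      _ = (3 * (k + 1 : ℕ) + 1) * M := by push_cast; ring

include hout hM in
/-- **Bottom-face spatial links are single plaquettes** (the plaquette below has three outside links): `ℓ(V(x,i)) ≤ M` if `x₀ = 0`. -/
theorem ell_spatial_bottom {x : Site 4} {i : Fin 4} (hi : i ≠ 0) (hx : x 0 = 0) : ℓ (V (x, i)) ≤ M := by
  have h := hM (x - Pi.single 0 1) 0 i
  rw [hol_eq] at h
  have e1 : V (x - Pi.single 0 1, 0) = 1 := V_eq_one_of_fst V hout ⟨0, Or.inl (by simp; omega)⟩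
  have e2 : x - Pi.single 0 1 + Pi.single 0 1 = x := by simp
  have e3 : V (x - Pi.single 0 1 + Pi.single i 1, 0) = 1 :=
    V_eq_one_of_fst V hout ⟨0, Or.inl (by simp [Pi.single_eq_of_ne hi.symm]; omega)⟩
  have e4 : V (x - Pi.single 0 1, i) = 1 := V_eq_one_of_fst V hout ⟨0, Or.inl (by simp; omega)⟩
  simp only [e1, e2, e3, e4, one_mul, inv_one, mul_one] at h
  exact h

include hℓ1 hℓmul hℓinv hout hforest hM in
/-- **(B) Bottom temporal links** `T(x') = V((0,x'), e₀)`: by induction on the distance to the face `x₁ = 2H` along `e₁`,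
`ℓ(T) ≤ ((2H − x₁)·(6H + 1) + 1)·M` — each transverse step costs the bottom plaquette, the bottom spatial link (`≤ M`), the
height-one spatial link (`≤ (6H − 2)M`) and the next bottom temporal link. -/
theorem ell_temporal_bottom (hH : 1 ≤ H) : ∀ (n : ℕ) (x : Site 4), x 0 = 0 → x 1 = 2 * (H : ℤ) - n → 0 ≤ x 1 →
    ℓ (V (x, 0)) ≤ (n * (6 * H + 1) + 1) * M := by
  have hM0 := poincare_M_nonneg ℓ hℓ1 V hM
  have h10 : (1 : Fin 4) ≠ 0 := by decide
  intro n
  induction n with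
  | zero =>
    intro x _ hx1 _
    have := ell_temporal_face ℓ hℓinv V hout hM h10 (Or.inr (by simpa using hx1))
    simpa using this
  | succ n ih =>
    intro x hx0 hx1 hx1'
    -- the bottom plaquette (x; 0, 1)
    have h := hM x 0 1
    rw [hol_eq] at h
    have hsolve : V (x, 0) = plaquetteHolonomyZd V x 0 1 * (V (x, 1) * V (x + Pi.single 1 1, 0) *
        (V (x + Pi.single 0 1, 1))⁻¹) := by
      rw [hol_eq]; group
    have hb : ℓ (V (x, 1)) ≤ M := ell_spatial_bottom ℓ V hout hM h10 hx0
    have hnext : ℓ (V (x + Pi.single 1 1, 0)) ≤ (n * (6 * H + 1) + 1) * M :=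
      ih (x + Pi.single 1 1) (by simp [hx0]) (by simp; omega) (by simp; omega)
    have hup : ℓ (V (x + Pi.single 0 1, 1)) ≤ (3 * (2 * H - 1 : ℕ) + 1) * M := by
      refine ell_spatial ℓ hℓ1 hℓmul hℓinv V hout hforest hM (2 * H - 1) (x + Pi.single 0 1) 1 h10 ?_ ?_
      · simp [hx0]; omega
      · omega
    rw [hsolve]
    have hcast : ((2 * H - 1 : ℕ) : ℝ) = 2 * H - 1 := by
      rw [Nat.cast_sub (by omega)]; push_cast; ring
    calc ℓ (plaquetteHolonomyZd V x 0 1 * (V (x, 1) * V (x + Pi.single 1 1, 0) * (V (x + Pi.single 0 1, 1))⁻¹))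
        ≤ ℓ (plaquetteHolonomyZd V x 0 1) + ℓ (V (x, 1) * V (x + Pi.single 1 1, 0) * (V (x + Pi.single 0 1, 1))⁻¹) :=
          hℓmul _ _
      _ ≤ M + (M + (n * (6 * H + 1) + 1) * M + (3 * (2 * H - 1 : ℕ) + 1) * M) := by
          refine add_le_add (hM x 0 1) ?_
          calc _ ≤ ℓ (V (x, 1) * V (x + Pi.single 1 1, 0)) + ℓ (V (x + Pi.single 0 1, 1))⁻¹ := hℓmul _ _
            _ ≤ (ℓ (V (x, 1)) + ℓ (V (x + Pi.single 1 1, 0))) + ℓ (V (x + Pi.single 0 1, 1)) := by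
                rw [hℓinv]; exact add_le_add (hℓmul _ _) le_rfl
            _ ≤ _ := by linarith
      _ ≤ ((n + 1 : ℕ) * (6 * H + 1) + 1) * M := by rw [hcast]; push_cast; nlinarith [hM0]

include hℓ1 hℓmul hℓinv hout hforest hM in
/-- **Uniform quantitative Poincaré bound in the temporal-forest gauge**: EVERY link of a configuration which is `1` off the cold box
and on the temporal forest satisfies `ℓ(V_e) ≤ (12H² + 2H + 1)·M ≤ 15H²·M`, `M` = the largest plaquette deviation `ℓ(V_p)`
(`H ≥ 1`).  The worst links are the bottom temporal ones (full temporal-line holonomies closed through the cold wall: area `∼ H²`);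
spatial links are `≤ (6H+1)M`, other temporal links `≤ M`. -/
theorem ell_le_uniform (hH : 1 ≤ H) (e : Literature.MathematicalPhysics.QuantumLattice.ZdEdge 4) :
    ℓ (V e) ≤ (12 * (H : ℝ) ^ 2 + 2 * H + 1) * M := by
  have hM0 := poincare_M_nonneg ℓ hℓ1 V hM
  have hH' : (1 : ℝ) ≤ H := by exact_mod_cast hH
  obtain ⟨x, i⟩ := e
  by_cases hmem : (x, i) ∈ boxEdges 4 (2 * H + 1)
  · have hmem' := mem_boxEdges_iff.1 hmem
    by_cases hi : i = 0
    · subst hi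
      by_cases hx0 : 1 ≤ x 0
      · have := ell_temporal_of_pos ℓ hℓ1 hℓinv V hout hforest hM hx0
        nlinarith
      · have hx00 : x 0 = 0 := by have := (hmem'.1 0).1; omega
        have hx1 := hmem'.1 1
        push_cast at hx1
        obtain ⟨n, hn⟩ : ∃ n : ℕ, x 1 = 2 * (H : ℤ) - n := ⟨(2 * (H : ℤ) - x 1).toNat, by omega⟩
        have hnle : (n : ℝ) ≤ 2 * H := by
          have : (n : ℤ) ≤ 2 * H := by omega
          exact_mod_cast this
        have := ell_temporal_bottom ℓ hℓ1 hℓmul hℓinv V hout hforest hM hH n x hx00 hn hx1.1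
        calc ℓ (V (x, 0)) ≤ (n * (6 * H + 1) + 1) * M := this
          _ ≤ (2 * H * (6 * H + 1) + 1) * M := by gcongr
          _ = (12 * (H : ℝ) ^ 2 + 2 * H + 1) * M := by ring
    · by_cases hx0 : x 0 = 0
      · have := ell_spatial_bottom ℓ V hout hM hi hx0
        nlinarith
      · have hx0' := hmem'.1 0
        push_cast at hx0'
        obtain ⟨k, hk⟩ : ∃ k : ℕ, x 0 = 2 * (H : ℤ) - k := ⟨(2 * (H : ℤ) - x 0).toNat, by omega⟩
        have hk' : (k : ℤ) ≤ 2 * H - 1 := by omega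
        have := ell_spatial ℓ hℓ1 hℓmul hℓinv V hout hforest hM k x i hi hk hk'
        have hkr : (k : ℝ) ≤ 2 * H - 1 := by exact_mod_cast hk'
        calc ℓ (V (x, i)) ≤ (3 * k + 1) * M := this
          _ ≤ (3 * (2 * H - 1) + 1) * M := by gcongr
          _ ≤ (12 * (H : ℝ) ^ 2 + 2 * H + 1) * M := by
              apply mul_le_mul_of_nonneg_right _ hM0; nlinarith
  · rw [hout _ hmem, hℓ1]; positivity

end Poincare

end Summit.QuantumFields.YangMills.Theorems.WeakCouplingRates

end
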